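import Mathlib
import Summits.NavierStokesRegularity.NavierStokesRegularity.Theses.UnthreadedDoor
import Summits.NavierStokesRegularity.NavierStokesRegularity.Theorems.LocalSineTubeDoorProfileAlignedWindowRigidityAncient
import Literature.Analysis.FluidPDE.KNSSTypeIRateLiouvilleMild
import Literature.Analysis.FluidPDE.TypeIAncientMild
import Literature.Analysis.FluidPDE.MildSolution
import Literature.Analysis.FluidPDE.VectorCalculus
import HarnessLib

/-!
# `UnthreadedDoor.ShiftedPoloidalClass` — packaging of a Type-I ancient Oseen-mild poloidal profile
  for the shared kernel `PoloidalLiouville`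
  (item stmt-NavierStokesRegularity-27410, support of route UnthreadedDoor)

**Statement (verbatim route decl).** A Type-I ancient Oseen-mild divergence-free profile `v` on
`(−∞,0) × ℝ³` (`‖v(s,y)‖ ≤ C/√(−s)`, continuous on the open slab, `v(t) = e^{(t−s)Δ}v(s) − B_s(v,v)(t)`
for all `s < t < 0`, divergence-free slices) with `⟪curl v(s)(y), y⟫ = 0` for all `s < 0`, `y`,
shifted in time by any `δ > 0` (`w(t,x) = v(t−δ,x)`), is a bounded ancient mild solution in duality
form (`IsBoundedAncientMildSolution 1 w`), has strongly measurable slices, is jointly `C^∞` on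
`(−∞,0) × ℝ³`, and its vorticity is tangent to the spheres about `x₀ = 0`.

PROOF (the item's plan; every analytic input is a tree theorem).
* duality-form mild + bounded: the time shift `τ ↦ v(τ − δ)` is continuous on the open slab,
  GLOBALLY bounded by `|C|/√δ` (`bdd_of_hasTypeITimeDecay`) and Oseen-mild between negative times
  (`LocalSineTubeDoorProfileAlignedWindowRigidityAncient.shift`, via `oseenDuhamel_translate`); its
  slices are `C¹` (the class is the tree's `IsTypeIAncientMild`, joint smoothness from joint
  analyticity `analyticOnNhd_uncurry`) and divergence free, hence weakly divergence free
  (`VectorCalculus.IsDivFree.isWeaklyDivFree_holds`); so Lemarié-Rieusset's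
  `isBoundedAncientMildSolution_of_oseen` (Oseen-mild ⇒ duality-form mild) applies;
* measurable slices: continuity of the slices (`continuous_slice`);
* joint `C^∞`: `IsTypeIAncientMild.1` composed with the smooth shift `(t,x) ↦ (t−δ,x)`, which maps
  the open slab into itself;
* tangency: `⟪x − 0, curl w(t)(x)⟫ = ⟪curl v(t−δ)(x), x⟫ = 0`.

HONEST FRAMING: packaging/bookkeeping (support item of a DRAFT door route) about HYPOTHETICAL Type-I
profiles; nothing here bears on `PoloidalLiouville` (stmt-1222), on the door's `Target`, or on
Navier–Stokes regularity — all OPEN.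
-/

noncomputable section

set_option linter.dupNamespace false

namespace Summit.NavierStokesRegularity.NavierStokesRegularity.Theorems

open MeasureTheory Set Filter Topology Metric Function
open Literature.Analysis Literature.Analysis.FluidPDE
open scoped RealInnerProductSpace InnerProductSpace ENNReal

open Summit.NavierStokesRegularity.NavierStokesRegularity.Theorems.LocalSineTubeDoorProfileAlignedWindowRigidityAncient in
/-- **Item stmt-NavierStokesRegularity-27410** (`UnthreadedDoor.ShiftedPoloidalClass`): the time shifts
`w = v(· − δ)`, `δ > 0`, of a Type-I ancient Oseen-mild poloidal profile are bounded ancient mild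
solutions in duality form, with strongly measurable and jointly smooth slices, and poloidal about the
origin. [cite: LemarieRieusset2016, Thm. 6.1; KochNadirashviliSereginSverak2009, §4 (arXiv:0709.3599)] -/
theorem unthreadedDoor_shiftedPoloidalClass_proof :
    Summit.NavierStokesRegularity.NavierStokesRegularity.Theses.UnthreadedDoor.ShiftedPoloidalClass := by
  unfold Summit.NavierStokesRegularity.NavierStokesRegularity.Theses.UnthreadedDoor.ShiftedPoloidalClass
  intro C v hrate hcont hmild hdiv htor δ hδ
  -- the class is the tree's `IsTypeIAncientMild` (joint smoothness from joint analyticity)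
  have hA : IsTypeIAncientMild C v := by
    refine ⟨(analyticOnNhd_uncurry hcont (bdd_of_hasTypeITimeDecay hrate) hmild).contDiffOn_of_completeSpace,
      fun t ht => hdiv t ht, fun s t hst ht x => ?_, hrate⟩
    rw [heatFlow_of_pos _ (sub_pos.2 hst)]
    exact hmild s t hst ht x
  -- the shift in the tree's `τ + -δ` form
  have hw : (fun t x => v (t - δ) x) = fun τ => v (τ + -δ) := by
    funext t x
    rw [sub_eq_add_neg]
  obtain ⟨hc, hb, hm⟩ := shift hcont (bdd_of_hasTypeITimeDecay hrate) hmild hδ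
  refine ⟨?_, ?_, ?_, ?_⟩
  · -- bounded ancient mild solution in duality form (Lemarié-Rieusset Thm 6.1)
    rw [hw]
    refine isBoundedAncientMildSolution_of_oseen one_pos hc hb (fun t ht => ?_) fun s t hst ht x => ?_
    · have h1 : ContDiff ℝ 1 (v (t + -δ)) :=
        (hA.contDiff_slice (by linarith)).of_le (by exact_mod_cast le_top)
      exact VectorCalculus.IsDivFree.isWeaklyDivFree_holds (hdiv (t + -δ) (by linarith)) h1
    · rw [one_mul]
      exact hm s t hst ht x
  · -- strongly measurable slices
    intro t ht
    exact (continuous_slice hcont (t := t - δ) (by linarith)).aestronglyMeasurable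
  · -- jointly smooth on the open slab: compose with the smooth shift `(t, x) ↦ (t − δ, x)`
    have hφ : ContDiff ℝ (⊤ : ℕ∞)
        (fun z : ℝ × EuclideanSpace ℝ (Fin 3) => (z.1 - δ, z.2)) :=
      (contDiff_fst.sub contDiff_const).prodMk contDiff_snd
    have hmaps : MapsTo (fun z : ℝ × EuclideanSpace ℝ (Fin 3) => (z.1 - δ, z.2))
        (Iio (0 : ℝ) ×ˢ univ) (Iio (0 : ℝ) ×ˢ univ) := by
      intro z hz
      obtain ⟨h1, -⟩ := mem_prod.1 hz
      refine mem_prod.2 ⟨?_, mem_univ _⟩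
      simp only [mem_Iio] at h1 ⊢
      linarith
    have hcomp := hA.1.comp hφ.contDiffOn hmaps
    exact hcomp
  · -- tangency to the spheres about the origin
    intro t ht x
    rw [sub_zero, real_inner_comm]
    exact htor (t - δ) (by linarith) x

end Summit.NavierStokesRegularity.NavierStokesRegularity.Theorems

end
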